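import Mathlib
import Summits.ValiantsHypothesis.ValiantsHypothesis.Theses.ProofCarryingSymmetry
import Summits.ValiantsHypothesis.ValiantsHypothesis.Theorems.ProofCarryingSymmetryRestorationQPPolylogWidth
import Summits.ValiantsHypothesis.ValiantsHypothesis.Theorems.ProofCarryingSymmetryRestorationQPConsistency
import Summits.ValiantsHypothesis.ValiantsHypothesis.Theorems.ProofCarryingSymmetryRestorationQPLineGlue
import Summits.ValiantsHypothesis.ValiantsHypothesis.Theorems.ProofCarryingSymmetryRestorationQPProvabilityNecessity

/-!
# STRATEGY CENSUS s6 — typed companion (crux `RestorationQP`, item stmt-ValiantsHypothesis-10343)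

Strategist seat `cstrat-…-s6` (independent census, family `-s`).  This file only TYPES the statements the
census `STRATEGY-CENSUS-s6.md` talks about and re-derives, from LANDED theorems, the implications it
relies on.  Nothing here is a new claim; every `theorem` is a one-line composition of tree theorems.

* §1  the chain of strictly-weaker-looking intermediates between the crux and the summit:
      `RestorationQP → WidthLawVP → NoArithmeticCFI → ValiantsHypothesis` (all landed);
* §2  the candidate strengthenings S⁺ (`UniformRestorationP`, `DegreeFreeRestorationQP`) and that they
      imply the crux;
* §3  the typed decompositions: the registered one (T′ ∧ S2⁗, by name) and the width split
      `WidthLawVP ∧ WidthToCircuitsQP → RestorationQP` (assembly proved; INADMISSIBLE as a strategist split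
      because the first piece alone decides the summit, §1).
-/

set_option linter.dupNamespace false

noncomputable section

open scoped Classical

namespace Summit.ValiantsHypothesis.ValiantsHypothesis.Cruxes.RestorationQP.StrategyCensusS6

open Literature.Computability.AlgebraicComplexity
open Literature.ModelTheory.FiniteModelTheory
open Summit.ValiantsHypothesis.ValiantsHypothesis.Theses.ProofCarryingSymmetry (RestorationQP)
open Summit.ValiantsHypothesis.ValiantsHypothesis.Theorems

/-- Diagonal `S_n`-invariance of a family `f_n ∈ ℂ[x_ij : i j < n]` (`x_ij ↦ x_{σ i, σ j}`). -/
def DiagInvariant (f : (n : ℕ) → MvPolynomial (Fin n × Fin n) ℂ) : Prop :=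
  ∀ (n : ℕ) (σ : Equiv.Perm (Fin n)),
    MvPolynomial.rename (fun x : Fin n × Fin n => σ • x) (f n) = f n

/-- The `0/1` adjacency point of a graph on `Fin n`. -/
def adjPt {n : ℕ} (X : SimpleGraph (Fin n)) : Fin n × Fin n → ℂ :=
  Set.indicator {ij : Fin n × Fin n | X.Adj ij.1 ij.2} 1

/-! ### §1  Strictly-weaker-looking intermediates (each still decides the summit) -/

/-- **Width law at polylog scale** (lead c4's re-crux candidate): every diagonally invariant VP family is,
uniformly in `n`, constant on `≡^{C^{polylog n}}`-classes of graphs. -/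
def WidthLawVP : Prop :=
  ∀ f : (n : ℕ) → MvPolynomial (Fin n × Fin n) ℂ, DiagInvariant f → IsVPFamily f →
    ∃ c' : ℕ, ∀ (n : ℕ) (X Y : SimpleGraph (Fin n)),
      CkEquiv ((Nat.log 2 n + c') ^ c') X Y →
        MvPolynomial.eval (adjPt X) (f n) = MvPolynomial.eval (adjPt Y) (f n)

/-- **No arithmetic CFI family** (linear scale, infinitely often) — the weakest intermediate typed in the
tree; its negation is the crux's construction/kill item. -/
def NoArithmeticCFI : Prop := ¬ ArithmeticCFI

theorem widthLawVP_of_crux : RestorationQP → WidthLawVP :=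
  fun h f hi hv => widthLawVP_of_restorationQP h f hi hv

theorem noArithmeticCFI_of_widthLawVP : WidthLawVP → NoArithmeticCFI :=
  fun h => not_arithmeticCFI_of_widthLawVP (fun f hi hv => h f hi hv)

theorem summit_of_noArithmeticCFI : NoArithmeticCFI → _root_.ValiantsHypothesis :=
  fun h => arithmeticCFI_or_valiantsHypothesis.resolve_left h

/-- The whole chain: every rung below the crux is still a SUFFICIENT condition for the summit, so
re-cruxing on any of them thins the route but never takes it "short of the summit". -/
theorem summit_of_widthLawVP : WidthLawVP → _root_.ValiantsHypothesis :=
  fun h => summit_of_noArithmeticCFI (noArithmeticCFI_of_widthLawVP h)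

/-! ### §2  Strengthenings S⁺ -/

/-- **S⁺₁ = uniform polynomial restoration** (size-robust, degree-free, one exponent): every straight-line
circuit computing a diagonally invariant polynomial has a symmetric circuit polynomial in ITS size. -/
def UniformRestorationP : Prop :=
  ∃ c : ℕ, ∀ (n : ℕ) (C : PICircuit ℂ (Fin n × Fin n)),
    (∀ σ : Equiv.Perm (Fin n),
      MvPolynomial.rename (fun x : Fin n × Fin n => σ • x) C.eval = C.eval) →
    ∃ (G : Type) (_ : Fintype G) (D : LabelledArithCircuit ℂ (Fin n × Fin n) Unit G),
      D.IsSymmetric (Equiv.Perm (Fin n)) ∧ D.eval (D.output ()) = C.eval ∧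
      Fintype.card G ≤ (C.size + n + 2) ^ c

theorem crux_of_uniformRestorationP : UniformRestorationP → RestorationQP :=
  fun h => restorationQP_of_uniformRestoration h

/-- **S⁺₂ = degree-free quasi-polynomial restoration**: drop the degree bound of VP (polynomial-size
straight-line circuits of any degree). -/
def DegreeFreeRestorationQP : Prop :=
  ∀ f : (n : ℕ) → MvPolynomial (Fin n × Fin n) ℂ, DiagInvariant f →
    (∃ c : ℕ, ∀ n : ℕ, ∃ C : PICircuit ℂ (Fin n × Fin n), C.eval = f n ∧ C.size ≤ (n + 2) ^ c) →
    ∃ c : ℕ, ∀ n : ℕ, ∃ (G : Type) (_ : Fintype G)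
      (C : LabelledArithCircuit ℂ (Fin n × Fin n) Unit G),
      C.IsSymmetric (Equiv.Perm (Fin n)) ∧ C.eval (C.output ()) = f n ∧
      Fintype.card G ≤ 2 ^ ((Nat.log 2 n + c) ^ c)

theorem crux_of_degreeFreeRestorationQP : DegreeFreeRestorationQP → RestorationQP := by
  intro hD
  unfold Summit.ValiantsHypothesis.ValiantsHypothesis.Theses.ProofCarryingSymmetry.RestorationQP
  intro f hinv hVP
  obtain ⟨c₁, hc₁⟩ := stub_vpFamily_piCircuit f hVP
  refine hD f hinv ⟨c₁, fun n => ?_⟩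
  obtain ⟨-, C, hCeval, hCsize⟩ := hc₁ n
  exact ⟨C, hCeval, hCsize⟩

/-! ### §3  Typed decompositions -/

/-- The registered decomposition `T′ ∧ S2⁗ → RestorationQP` and the necessity of `T′`, by name. -/
example := @restorationQP_of_invarianceProvableQP'_of_proofsToDistEquiv
example := @invarianceProvableQP_of_restorationQP

/-- **WidthToCircuits** (arithmetic Otto-type inversion at polylog width): an invariant VP family of
polylog counting width has quasi-polynomial symmetric circuits. -/
def WidthToCircuitsQP : Prop :=
  ∀ f : (n : ℕ) → MvPolynomial (Fin n × Fin n) ℂ, DiagInvariant f → IsVPFamily f →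
    (∃ c' : ℕ, ∀ (n : ℕ) (X Y : SimpleGraph (Fin n)),
      CkEquiv ((Nat.log 2 n + c') ^ c') X Y →
        MvPolynomial.eval (adjPt X) (f n) = MvPolynomial.eval (adjPt Y) (f n)) →
    ∃ c : ℕ, ∀ n : ℕ, ∃ (G : Type) (_ : Fintype G)
      (C : LabelledArithCircuit ℂ (Fin n × Fin n) Unit G),
      C.IsSymmetric (Equiv.Perm (Fin n)) ∧ C.eval (C.output ()) = f n ∧
      Fintype.card G ≤ 2 ^ ((Nat.log 2 n + c) ^ c)

/-- The width split has a proved (trivial) assembly … -/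
theorem crux_of_widthSplit : WidthLawVP → WidthToCircuitsQP → RestorationQP := by
  intro hW hT
  unfold Summit.ValiantsHypothesis.ValiantsHypothesis.Theses.ProofCarryingSymmetry.RestorationQP
  intro f hinv hVP
  exact hT f hinv hVP (hW f hinv hVP)

/-- … but is inadmissible as a strategist `--split`: its first piece alone decides the summit. -/
example : WidthLawVP → _root_.ValiantsHypothesis := summit_of_widthLawVP

end Summit.ValiantsHypothesis.ValiantsHypothesis.Cruxes.RestorationQP.StrategyCensusS6

end
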